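import Literature.AnabelianGeometry.EtaleTheta.BiKummerThm44SubModelConnectedBinj
import Literature.AnabelianGeometry.EtaleTheta.BiKummerThm44SubNHSatRootsReading

/-!
# [EtTh] Theorem 4.4 (i)(ii)(iii) at the GENUINE connected base: the binder `hBinj` in BASE-IMAGE form
# (injectivity of `B₀^Λ` only along the coverings `D → D₀` actually used) — proof-only

S. Mochizuki, *The étale theta function and its Frobenioid-theoretic manifestations*, Publ. RIMS **45** (2009)
[MochizukiEtTh2009], §4, Thm 4.4 (i)–(iii), PDF p.94 (printed p.320), proof PDF p.95; Def 3.3 (iii) PDF p.73, Def 3.6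
(i)(ii) PDF pp.76–77.  abc-iut cell, layer L2, plan/L2/SUBDAG-EtTh-Thm44.md (custodian lineage abc-iut-w5-d179), cone
nodes `EtTh:Thm4.4(i)`, `EtTh:Thm4.4(ii)`, `EtTh:Thm4.4(iii)`.  Seat abc-iut-w5-d179 (gen 4).  PROOF-ONLY (0 `def`s, no
`Prop` facts, no instances); nothing landed is edited or restated.

WHY.  `BiKummerThm44SubModelConnectedBinj.lean` (p434227) / `…BinjRootsReading.lean` (p435745) leave, as the ONLY
structural input of Thm 4.4 (i)(ii)(iii) at abc-iut-L2-t4's `mkOfConnectedTemperoid`, the binder of abc-iut-L2-t3 /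
abc-iut-w6-d048

  `hBinj : ∀ {Y Y' : D₀ᵒᵖ} (g : Y ⟶ Y'), Injective (T.BΛ.map g).hom`

quantified over ALL morphisms of the abstract Def 3.3 (iii) base `D₀`.  Print's `D₀ = B^temp(X^log)⁰` has CONNECTED
objects only, so there every transition map of `B₀(Y) = lim Mero(Z_∞)^{Gal(Z_∞/Y)}` is an inclusion of invariants;
but a typed `D₀` may contain non-connected objects — e.g. the category of ALL `G`-sets `Action (Type u) G` carrying
abc-iut-w6-d058's genuine Def 3.3 (iii) record `DivisorMonoids.ofGaloisAction` (p436163 + its sequel), where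
`B₀(∅) = 1` and `hBinj` as quantified is FALSE (pull-back to the empty `G`-set).  The proofs, however, use `hBinj` ONLY
along the images `base.map α` of morphisms `α` of the Frobenioid base `D` (abc-iut-L2-t3's `ratFnPull_injective`).  This
file re-keys the chain on that BASE-IMAGE form

  `hBD : ∀ {A B : D} (α : B ⟶ A), Injective (T.BΛ.map (tf.base.map α).op).hom`

(implied by `hBinj`; at `D = B^temp(Π^tp_X)⁰` every `α` is a surjection of transitive `Π^tp_X`-sets, which is the case
abc-iut-w6-d058's `GaloisAction.bZeroPull_injective` covers), so that the genuine Def 3.3 (iii) data can be plugged in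
without a vacuous hypothesis:

* §0 `TemperedFrobenioid.isMonoidOn_ratFnFunctor_of_baseInj` / `isFrobenioid_of_baseInj` — abc-iut-L2-t3's
  `isMonoidOn_ratFnFunctor` / `isFrobenioid_of_structural` (Def 3.6 (ii) «`B` a monoid on `D`», «`C` a Frobenioid»)
  with `hBinj` weakened to `hBD` (same proof, [FrdI] Def 1.1 (ii) / Thm 5.2 (ii));
* §1 `Thm44Hyp.thm44_mkOfConnectedTemperoid_of_baseInj(')` — **[EtTh] Thm 4.4 (i) ∧ (ii) ∧ (iii)-saturation ∧
  (`N`-th roots) at the genuine connected base ⇐ {`hBD₁`, `hBD₂`, T44-L15b}**, and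
  `thm44_mkOfConnectedTemperoid_rootsReading_of_baseInj(')` — **at the ROOTS READING of the `(N,H)`-slot
  ⇐ {`hBD₁`, `hBD₂`} and nothing else** (compositions over p434227 §0–§1 and abc-iut-w4-d044's
  `preservesNHSaturatedBsFld_rootsReading`, p431503).

HONEST FRAMING: refereed pre-IUT material ([FrdI]/[FrdII] 2008, [EtTh] 2009, [SemiAnbd] 2006); every theorem is an
implication for data so parametrised; the roots reading is WEAKER than print's cohomological [FrdII] Def 2.2 (ii)(c)
(label carried in the names); nothing here asserts that such data exist for an actual curve or bears on the disputed
[IUTchIII] Cor. 3.12; typed ≠ proved — here PROVED (kernel compositions).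
-/

noncomputable section

namespace Literature.AnabelianGeometry.EtaleTheta

open CategoryTheory Opposite Function Literature.AlgebraicGeometry.Frobenioids Literature.AnabelianGeometry.SemiGraphs

universe u₀ v₀ u v w

/-! ### §0 Def 3.6 (ii) «`B` is a monoid on `D`» / «`C` is a Frobenioid» from the BASE-IMAGE form of `hBinj` -/

namespace TemperedFrobenioid

section BaseInj

variable {D₀ : Type u₀} [Category.{v₀} D₀] {V : FrdIMonoidStub.{w}} {T : RealifiedDivisorMonoids (D₀ := D₀) V}
  {D : Type u} [Category.{v} D] {IsRational IsStrictlyRational : (Dᵒᵖ ⥤ CommMonCat.{w}) → Prop}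
  (C₀ : TemperedFrobenioid T D (treeCatVocab D IsRational IsStrictlyRational))

/-- **`B = B₀^Λ|_D ×_{(Φ^{ℝ-log})^gp} Φ^gp` is a monoid on `D`** ([FrdI] Def 1.1 (ii)) as soon as the pull-backs of
`B₀^Λ` ALONG THE IMAGES OF THE MORPHISMS OF `D` are injective and the FSM-morphisms of `D` are isomorphisms —
abc-iut-L2-t3's `isMonoidOn_ratFnFunctor` with its `D₀`-wide binder `hBinj` weakened to the base-image form `hBD`
(the only instances the proof uses). [cite: MochizukiEtTh2009, Def 3.6 p.77] -/
theorem isMonoidOn_ratFnFunctor_of_baseInj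
    (hBD : ∀ {A B : D} (α : B ⟶ A), Injective (T.BΛ.map (C₀.base.map α).op).hom)
    (hFSM : ∀ {A B : D} (α : B ⟶ A), IsFSM α → IsIso α) : IsMonoidOn C₀.ratFnFunctor where
  isCharInjective {A B} α := by
    refine ⟨?_, ?_⟩
    · haveI := C₀.isCancelMul_divisorMonoid A
      haveI := C₀.isCancelMul_divisorMonoid B
      exact C₀.ratFnPull_injective α.op (hBD α)
        (Literature.AlgebraicGeometry.Frobenioids.gpMap_injective (C₀.Φ.pull α.op)
          (C₀.isMonoidOn_divisorMonoid.isCharInjective α).1)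
    · have hs : Subsingleton (Associates (C₀.ratFnFunctor.obj (op A))) :=
        subsingleton_associates_of_forall_isUnit fun m => C₀.ratFn_isUnit T.isUnit_BΛ (op A) m
      exact fun a b _ => hs.elim a b
  bijective_of_isFSM α hα := by
    haveI := hFSM α hα
    exact C₀.ratFnPull_bijective_of_isIso α

/-- **The tempered Frobenioid IS a Frobenioid** ([FrdI] Def 1.3 via Thm 5.2 (ii), abc-iut-L2-t3's
`isFrobenioid_treeCatVocab_of_isMonoidOn`) modulo the base-image binder `hBD` and `hFSM` only.
[cite: MochizukiEtTh2009, Def 3.6 p.77] -/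
theorem isFrobenioid_of_baseInj
    (hBD : ∀ {A B : D} (α : B ⟶ A), Injective (T.BΛ.map (C₀.base.map α).op).hom)
    (hFSM : ∀ {A B : D} (α : B ⟶ A), IsFSM α → IsIso α) : PreFrobenioid.IsFrobenioid C₀.toElem :=
  C₀.isFrobenioid_treeCatVocab_of_isMonoidOn (C₀.isMonoidOn_ratFnFunctor_of_baseInj hBD hFSM)

/-- The `D₀`-wide binder `hBinj` implies the base-image form (so every `…_of_hBinj` theorem is a special case of the
`…_of_baseInj` ones). [cite: MochizukiEtTh2009, Def 3.6 p.77] -/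
theorem baseInj_of_hBinj (hBinj : ∀ {Y Y' : D₀ᵒᵖ} (g : Y ⟶ Y'), Injective (T.BΛ.map g).hom) :
    ∀ {A B : D} (α : B ⟶ A), Injective (T.BΛ.map (C₀.base.map α).op).hom :=
  fun α => hBinj (C₀.base.map α).op

end BaseInj

section ConnectedPartBaseInj

variable {G : Type u} [Group G] [TopologicalSpace G] {D₀ : Type u₀} [Category.{v₀} D₀] {V : FrdIMonoidStub.{w}}
  {T : RealifiedDivisorMonoids (D₀ := D₀) V}
  {IsRational IsStrictlyRational : ((ConnectedPart (BTemp G))ᵒᵖ ⥤ CommMonCat.{w}) → Prop}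
  (C₀ : TemperedFrobenioid T (ConnectedPart (BTemp G)) (treeCatVocab (ConnectedPart (BTemp G)) IsRational IsStrictlyRational))

/-- **At the genuine base `B^temp(Π)⁰`: «`B` a monoid on `D`» from the base-image binder `hBD` ALONE** (the FSM clause
is [FrdII] Ex 1.3 (i), `QuasiTemperoid.BTempConnected.connectedPart_isOfFSMType`). [cite: MochizukiEtTh2009, Def 3.6 p.77] -/
theorem isMonoidOn_ratFnFunctor_connectedPart_of_baseInj
    (hBD : ∀ {A B : ConnectedPart (BTemp G)} (α : B ⟶ A), Injective (T.BΛ.map (C₀.base.map α).op).hom) :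
    IsMonoidOn C₀.ratFnFunctor :=
  C₀.isMonoidOn_ratFnFunctor_of_baseInj hBD fun α hα =>
    (QuasiTemperoid.BTempConnected.connectedPart_isOfFSMType (G := G)).isIso_of_isFSM α hα

/-- **At the genuine base `B^temp(Π)⁰`: «`C` is a Frobenioid» from the base-image binder `hBD` ALONE.**
[cite: MochizukiEtTh2009, Def 3.6 p.77] -/
theorem isFrobenioid_connectedPart_of_baseInj
    (hBD : ∀ {A B : ConnectedPart (BTemp G)} (α : B ⟶ A), Injective (T.BΛ.map (C₀.base.map α).op).hom) :
    PreFrobenioid.IsFrobenioid C₀.toElem :=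
  C₀.isFrobenioid_treeCatVocab_of_isMonoidOn (C₀.isMonoidOn_ratFnFunctor_connectedPart_of_baseInj hBD)

end ConnectedPartBaseInj

end TemperedFrobenioid

/-! ### §1 [EtTh] Thm 4.4 (i)(ii)(iii) at the genuine connected base from the base-image binders `hBD₁ / hBD₂` -/

namespace BiKummerSetting

section Connected

variable {K : Type u₀} [Field K] {K' : Type u₀} [Field K'] {X₁ : SemiGraphs.TemperedArithmeticGroup.{u₀} K}
  {X₂ : SemiGraphs.TemperedArithmeticGroup.{u₀} K'} {D₀ : Type u₀} [Category.{v₀} D₀] {D₀' : Type u₀}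
  [Category.{v₀} D₀'] {T₁ : RealifiedDivisorMonoids (D₀ := D₀) treeMonoidVocab.{w}}
  {T₂ : RealifiedDivisorMonoids (D₀ := D₀') treeMonoidVocab.{w}}
  {IsRational₁ IsStrictlyRational₁ : ((ConnectedPart (BTemp X₁.Pi))ᵒᵖ ⥤ CommMonCat.{w}) → Prop}
  {IsRational₂ IsStrictlyRational₂ : ((ConnectedPart (BTemp X₂.Pi))ᵒᵖ ⥤ CommMonCat.{w}) → Prop}
  (tf₁ : TemperedFrobenioid T₁ (ConnectedPart (BTemp X₁.Pi))
    (treeCatVocab (ConnectedPart (BTemp X₁.Pi)) IsRational₁ IsStrictlyRational₁))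
  (hZ₁ : tf₁.monoidType = MonoidType.Z) (hP₁ : ∀ A : (ConnectedPart (BTemp X₁.Pi))ᵒᵖ, IsPerfect (tf₁.Φ.carrier A))
  (NH₁ : Subgroup (Field.absoluteGaloisGroup K) → tf₁.category → ℕ+ → Prop)
  (A₁ : tf₁.category) (hA₁ : PreFrobenioid.IsFrobeniusTrivial tf₁.toElem A₁)
  (hA₁' : SemiGraphs.IsGaloisObj A₁.base.obj)
  (tf₂ : TemperedFrobenioid T₂ (ConnectedPart (BTemp X₂.Pi))
    (treeCatVocab (ConnectedPart (BTemp X₂.Pi)) IsRational₂ IsStrictlyRational₂))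
  (hZ₂ : tf₂.monoidType = MonoidType.Z) (hP₂ : ∀ B : (ConnectedPart (BTemp X₂.Pi))ᵒᵖ, IsPerfect (tf₂.Φ.carrier B))
  (NH₂ : Subgroup (Field.absoluteGaloisGroup K') → tf₂.category → ℕ+ → Prop)
  (A₂ : tf₂.category) (hA₂ : PreFrobenioid.IsFrobeniusTrivial tf₂.toElem A₂)
  (hA₂' : SemiGraphs.IsGaloisObj A₂.base.obj)

/-- **[EtTh] Thm 4.4 (i) ∧ (ii) ∧ (iii)-saturation ∧ (`N`-th roots) at the genuine connected base `B^temp(Π^tp_X)⁰`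
⇐ {`hBD₁`, `hBD₂` (base-image injectivity of the Def 3.6 (i) datum `B₀^Λ`), T44-L15b}** for `ψ = psiModel hF₁ hF₂ h3`
over ANY proofs `hF₁ hF₂ h3` (proof-irrelevant; e.g. `isFrobenioid_connectedPart_of_baseInj hBD_i` and
`preservesFrobeniusStructure_of_isOfFSMType`): p434227's `…_of_isOfFSMType` compositions with `hBmon_i :=
isMonoidOn_ratFnFunctor_connectedPart_of_baseInj hBD_i`, «`D_i` of FSM-type» := [FrdII] Ex 1.3 (i), «`D_i` slim» :=
[SemiAnbd] Rmk 3.4.1 / Ex 3.10 (`TemperedArithmeticGroup.isSlim_connectedPart`), T44-L09c := abc-iut-w5-d013's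
`galoisCompatible_mkOfConnectedTemperoid`. [cite: MochizukiEtTh2009, Thm 4.4 p.94] -/
theorem Thm44Hyp.thm44_mkOfConnectedTemperoid_of_baseInj
    (h : Thm44Hyp (mkOfConnectedTemperoid X₁ tf₁ hZ₁ hP₁ NH₁ A₁ hA₁ hA₁')
      (mkOfConnectedTemperoid X₂ tf₂ hZ₂ hP₂ NH₂ A₂ hA₂ hA₂'))
    (hF₁ : PreFrobenioid.IsFrobenioid tf₁.toElem) (hF₂ : PreFrobenioid.IsFrobenioid tf₂.toElem)
    (h3 : h.PreservesFrobeniusStructure)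
    (hBD₁ : ∀ {A B : ConnectedPart (BTemp X₁.Pi)} (α : B ⟶ A), Injective (T₁.BΛ.map (tf₁.base.map α).op).hom)
    (hBD₂ : ∀ {A B : ConnectedPart (BTemp X₂.Pi)} (α : B ⟶ A), Injective (T₂.BΛ.map (tf₂.base.map α).op).hom)
    (h15 : h.PreservesNHSaturatedBsFld) :
    Thm44_i h ∧ Thm44_ii h (h.psiModel hF₁ hF₂ h3) ∧ Thm44_iii h (h.psiModel hF₁ hF₂ h3) ∧
      h.PreservesNthRoots (h.psiModel hF₁ hF₂ h3) (fun φ f => tf₁.pullFracModel φ f)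
        (fun φ f => tf₂.pullFracModel φ f) :=
  ⟨h.thm44_i_mkOfConnectedTemperoid _ _ _ _ _ _ _ _ _ _ _ _ _ _ hF₂ h3,
    h.thm44_ii_mkOfConnectedTemperoid_of_isFrobenioid hF₁ hF₂ h3,
    h.thm44_iii_of_isOfFSMType _ (tf₁.isMonoidOn_ratFnFunctor_connectedPart_of_baseInj hBD₁)
      (tf₂.isMonoidOn_ratFnFunctor_connectedPart_of_baseInj hBD₂)
      QuasiTemperoid.BTempConnected.connectedPart_isOfFSMType QuasiTemperoid.BTempConnected.connectedPart_isOfFSMType h15,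
    h.preservesNthRoots_mkOfModelCanonical_of_isOfFSMType hF₁ hF₂ h3
      (tf₁.isMonoidOn_ratFnFunctor_connectedPart_of_baseInj hBD₁)
      (tf₂.isMonoidOn_ratFnFunctor_connectedPart_of_baseInj hBD₂)
      QuasiTemperoid.BTempConnected.connectedPart_isOfFSMType QuasiTemperoid.BTempConnected.connectedPart_isOfFSMType
      X₁.isSlim_connectedPart X₂.isSlim_connectedPart
      (h.galoisCompatible_mkOfConnectedTemperoid _ _ _ _ _ _ _ _ _ _ _ _ _ _) h15⟩

/-- **The same with every ψ-slot proof supplied from `hBD`** — literally ⇐ {`hBD₁`, `hBD₂`, T44-L15b}.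
[cite: MochizukiEtTh2009, Thm 4.4 p.94] -/
theorem Thm44Hyp.thm44_mkOfConnectedTemperoid_of_baseInj'
    (h : Thm44Hyp (mkOfConnectedTemperoid X₁ tf₁ hZ₁ hP₁ NH₁ A₁ hA₁ hA₁')
      (mkOfConnectedTemperoid X₂ tf₂ hZ₂ hP₂ NH₂ A₂ hA₂ hA₂'))
    (hBD₁ : ∀ {A B : ConnectedPart (BTemp X₁.Pi)} (α : B ⟶ A), Injective (T₁.BΛ.map (tf₁.base.map α).op).hom)
    (hBD₂ : ∀ {A B : ConnectedPart (BTemp X₂.Pi)} (α : B ⟶ A), Injective (T₂.BΛ.map (tf₂.base.map α).op).hom)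
    (h15 : h.PreservesNHSaturatedBsFld) :
    Thm44_i h ∧
      Thm44_ii h (h.psiModel (tf₁.isFrobenioid_connectedPart_of_baseInj hBD₁)
        (tf₂.isFrobenioid_connectedPart_of_baseInj hBD₂)
        (h.preservesFrobeniusStructure_of_isOfFSMType (tf₁.isMonoidOn_ratFnFunctor_connectedPart_of_baseInj hBD₁)
          (tf₂.isMonoidOn_ratFnFunctor_connectedPart_of_baseInj hBD₂)
          QuasiTemperoid.BTempConnected.connectedPart_isOfFSMType
          QuasiTemperoid.BTempConnected.connectedPart_isOfFSMType)) ∧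
      Thm44_iii h (h.psiModel (tf₁.isFrobenioid_connectedPart_of_baseInj hBD₁)
        (tf₂.isFrobenioid_connectedPart_of_baseInj hBD₂)
        (h.preservesFrobeniusStructure_of_isOfFSMType (tf₁.isMonoidOn_ratFnFunctor_connectedPart_of_baseInj hBD₁)
          (tf₂.isMonoidOn_ratFnFunctor_connectedPart_of_baseInj hBD₂)
          QuasiTemperoid.BTempConnected.connectedPart_isOfFSMType
          QuasiTemperoid.BTempConnected.connectedPart_isOfFSMType)) ∧
      h.PreservesNthRoots (h.psiModel (tf₁.isFrobenioid_connectedPart_of_baseInj hBD₁)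
        (tf₂.isFrobenioid_connectedPart_of_baseInj hBD₂)
        (h.preservesFrobeniusStructure_of_isOfFSMType (tf₁.isMonoidOn_ratFnFunctor_connectedPart_of_baseInj hBD₁)
          (tf₂.isMonoidOn_ratFnFunctor_connectedPart_of_baseInj hBD₂)
          QuasiTemperoid.BTempConnected.connectedPart_isOfFSMType
          QuasiTemperoid.BTempConnected.connectedPart_isOfFSMType))
        (fun φ f => tf₁.pullFracModel φ f) (fun φ f => tf₂.pullFracModel φ f) :=
  Thm44Hyp.thm44_mkOfConnectedTemperoid_of_baseInj tf₁ hZ₁ hP₁ NH₁ A₁ hA₁ hA₁' tf₂ hZ₂ hP₂ NH₂ A₂ hA₂ hA₂' h _ _ _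
    hBD₁ hBD₂ h15

/-- **[EtTh] Thm 4.4 (i) ∧ (ii) ∧ (iii) ∧ (`N`-th roots) at the genuine connected base AT THE ROOTS READING of the
`(N, H_⊙^{bs-fld})`-saturation slot ⇐ {`hBD₁`, `hBD₂`} and NOTHING ELSE** (`ψ = psiModel hF₁ hF₂ h3`, any proofs):
`thm44_mkOfConnectedTemperoid_of_baseInj` with T44-L15b supplied by abc-iut-w4-d044's
`preservesNHSaturatedBsFld_rootsReading` (p431503; the roots reading is WEAKER than print's cohomological
[FrdII] Def 2.2 (ii)(c)). [cite: MochizukiEtTh2009, Thm 4.4 p.94] -/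
theorem Thm44Hyp.thm44_mkOfConnectedTemperoid_rootsReading_of_baseInj
    (h : Thm44Hyp
      (mkOfConnectedTemperoid X₁ tf₁ hZ₁ hP₁
        (fun _ A M => ∀ (g : A.base ⟶ A₁.base) (x : tf₁.ratFnFunctor.obj (op A₁.base)),
          divB tf₁.divisorMonoid tf₁.ratFnFunctor tf₁.divBNatTrans (op A₁.base) x = 1 →
            ∃ ζ : tf₁.ratFnFunctor.obj (op A.base), ζ ^ (M : ℕ) = pull tf₁.ratFnFunctor g x)
        A₁ hA₁ hA₁')
      (mkOfConnectedTemperoid X₂ tf₂ hZ₂ hP₂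
        (fun _ A M => ∀ (g : A.base ⟶ A₂.base) (x : tf₂.ratFnFunctor.obj (op A₂.base)),
          divB tf₂.divisorMonoid tf₂.ratFnFunctor tf₂.divBNatTrans (op A₂.base) x = 1 →
            ∃ ζ : tf₂.ratFnFunctor.obj (op A.base), ζ ^ (M : ℕ) = pull tf₂.ratFnFunctor g x)
        A₂ hA₂ hA₂'))
    (hF₁ : PreFrobenioid.IsFrobenioid tf₁.toElem) (hF₂ : PreFrobenioid.IsFrobenioid tf₂.toElem)
    (h3 : h.PreservesFrobeniusStructure)
    (hBD₁ : ∀ {A B : ConnectedPart (BTemp X₁.Pi)} (α : B ⟶ A), Injective (T₁.BΛ.map (tf₁.base.map α).op).hom)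
    (hBD₂ : ∀ {A B : ConnectedPart (BTemp X₂.Pi)} (α : B ⟶ A), Injective (T₂.BΛ.map (tf₂.base.map α).op).hom) :
    Thm44_i h ∧ Thm44_ii h (h.psiModel hF₁ hF₂ h3) ∧ Thm44_iii h (h.psiModel hF₁ hF₂ h3) ∧
      h.PreservesNthRoots (h.psiModel hF₁ hF₂ h3) (fun φ f => tf₁.pullFracModel φ f)
        (fun φ f => tf₂.pullFracModel φ f) :=
  Thm44Hyp.thm44_mkOfConnectedTemperoid_of_baseInj tf₁ hZ₁ hP₁ _ A₁ hA₁ hA₁' tf₂ hZ₂ hP₂ _ A₂ hA₂ hA₂' h hF₁ hF₂ h3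
    hBD₁ hBD₂
    (Thm44Hyp.preservesNHSaturatedBsFld_rootsReading tf₁ hZ₁ hP₁ _ _ _ A₁ hA₁ hA₁' tf₂ hZ₂ hP₂ _ _ _ A₂ hA₂ hA₂' h
      hF₁ hF₂ h3)

/-- **The same with every ψ-slot proof supplied from `hBD`** — literally ⇐ {`hBD₁`, `hBD₂`} at the roots reading.
[cite: MochizukiEtTh2009, Thm 4.4 p.94] -/
theorem Thm44Hyp.thm44_mkOfConnectedTemperoid_rootsReading_of_baseInj'
    (h : Thm44Hyp
      (mkOfConnectedTemperoid X₁ tf₁ hZ₁ hP₁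
        (fun _ A M => ∀ (g : A.base ⟶ A₁.base) (x : tf₁.ratFnFunctor.obj (op A₁.base)),
          divB tf₁.divisorMonoid tf₁.ratFnFunctor tf₁.divBNatTrans (op A₁.base) x = 1 →
            ∃ ζ : tf₁.ratFnFunctor.obj (op A.base), ζ ^ (M : ℕ) = pull tf₁.ratFnFunctor g x)
        A₁ hA₁ hA₁')
      (mkOfConnectedTemperoid X₂ tf₂ hZ₂ hP₂
        (fun _ A M => ∀ (g : A.base ⟶ A₂.base) (x : tf₂.ratFnFunctor.obj (op A₂.base)),
          divB tf₂.divisorMonoid tf₂.ratFnFunctor tf₂.divBNatTrans (op A₂.base) x = 1 →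
            ∃ ζ : tf₂.ratFnFunctor.obj (op A.base), ζ ^ (M : ℕ) = pull tf₂.ratFnFunctor g x)
        A₂ hA₂ hA₂'))
    (hBD₁ : ∀ {A B : ConnectedPart (BTemp X₁.Pi)} (α : B ⟶ A), Injective (T₁.BΛ.map (tf₁.base.map α).op).hom)
    (hBD₂ : ∀ {A B : ConnectedPart (BTemp X₂.Pi)} (α : B ⟶ A), Injective (T₂.BΛ.map (tf₂.base.map α).op).hom) :
    Thm44_i h ∧
      Thm44_ii h (h.psiModel (tf₁.isFrobenioid_connectedPart_of_baseInj hBD₁)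
        (tf₂.isFrobenioid_connectedPart_of_baseInj hBD₂)
        (h.preservesFrobeniusStructure_of_isOfFSMType (tf₁.isMonoidOn_ratFnFunctor_connectedPart_of_baseInj hBD₁)
          (tf₂.isMonoidOn_ratFnFunctor_connectedPart_of_baseInj hBD₂)
          QuasiTemperoid.BTempConnected.connectedPart_isOfFSMType
          QuasiTemperoid.BTempConnected.connectedPart_isOfFSMType)) ∧
      Thm44_iii h (h.psiModel (tf₁.isFrobenioid_connectedPart_of_baseInj hBD₁)
        (tf₂.isFrobenioid_connectedPart_of_baseInj hBD₂)
        (h.preservesFrobeniusStructure_of_isOfFSMType (tf₁.isMonoidOn_ratFnFunctor_connectedPart_of_baseInj hBD₁)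
          (tf₂.isMonoidOn_ratFnFunctor_connectedPart_of_baseInj hBD₂)
          QuasiTemperoid.BTempConnected.connectedPart_isOfFSMType
          QuasiTemperoid.BTempConnected.connectedPart_isOfFSMType)) ∧
      h.PreservesNthRoots (h.psiModel (tf₁.isFrobenioid_connectedPart_of_baseInj hBD₁)
        (tf₂.isFrobenioid_connectedPart_of_baseInj hBD₂)
        (h.preservesFrobeniusStructure_of_isOfFSMType (tf₁.isMonoidOn_ratFnFunctor_connectedPart_of_baseInj hBD₁)
          (tf₂.isMonoidOn_ratFnFunctor_connectedPart_of_baseInj hBD₂)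
          QuasiTemperoid.BTempConnected.connectedPart_isOfFSMType
          QuasiTemperoid.BTempConnected.connectedPart_isOfFSMType))
        (fun φ f => tf₁.pullFracModel φ f) (fun φ f => tf₂.pullFracModel φ f) :=
  Thm44Hyp.thm44_mkOfConnectedTemperoid_rootsReading_of_baseInj tf₁ hZ₁ hP₁ A₁ hA₁ hA₁' tf₂ hZ₂ hP₂ A₂ hA₂ hA₂' h _ _
    _ hBD₁ hBD₂

end Connected

end BiKummerSetting

end Literature.AnabelianGeometry.EtaleTheta

end
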